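import Summits.QuantumFields.YangMills.Theorems.AllWindowsColdBoxBoxHighLineSmallFieldInsideFPByName

/-!
# `EventInsideFP` core (U5-BLOCKERS L4 «CubicCutInsideFP», generalised) — the two integral bounds and the arithmetic, with explicit parameters
# (planner ym-idea-2 g18, `Cruxes/BoxWindowHighSU2213/U5-BLOCKERS.md` §2 L4 «the same tail INSIDE the FP weight by the T-S5.6 domination trick»;
# LINE-20 U5 ⟨stmt-QuantumFields-24336⟩ `stub_landauThirdOrder`, LINE-19 S5 ⟨24004⟩/⟨24335⟩; objects from ✓`…Step2Defs` / ✓`…Step2Wick` BY NAME)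

Width seat `ym-line-sfw-p2-w4` (prover-ym-line-sfw-p2-w4-g29-0), continuing its lineage's T-S5.6 files (w4 g27 ✓`…SmallFieldInsideFPCore` /
✓`…SmallFieldInsideFP`, w4 g28 ✓`…SmallFieldInsideFPByName`).  T-S5.6 transfers the Gaussian rarity of the complement of the small-field box
`D = smallField H s` into the Faddeev–Popov chart weight `w_J = fpChartWeight β H r`; the U5 lift L4 wants the same transfer for a further cut of `D`
by an arbitrary measurable «bad event» `A` (the cubic cut `A = {|V₃| > λ}`, or any other).  This file: the parametrised cores (mirroring w4 g27's
✓`setIntegral_diff_le` / ✓`le_setIntegral_smallField`, but at the small-field scale `s`, NOT at the support scale `π·r` — the event lives inside `D`)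
and the arithmetic on OPAQUE reals (so that no tactic ever unfolds `Fintype.card (LandauFree H)` or an integral); the packaged statement
`SmallFieldFP.eventInsideFP` is the companion file `…EventInsideFP`.

* `setIntegral_inter_le` (NUMERATOR): given an action sandwich `|W + Φ − Q| ≤ εQ` and a determinant bound `|det F| ≤ K·D₀` on `smallField H T`, `s ≤ T`:
  `∫_{smallField s ∩ A} w_J ≤ K·D₀·((2π²)⁻¹)^n·∫_A e^{−β(1−ε)Q}`;
* `le_setIntegral_smallField_diff` (DENOMINATOR): with the two-sided determinant comparison on `smallField H T`, `0 ≤ t ≤ min(T, r, 1)`: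
  `K⁻¹·D₀·((2π²)⁻¹)^n·e^{−n(t²/3+t⁴)}·(∫_{smallField t} e^{−β(1+ε)Q} − ∫_A e^{−β(1+ε)Q}) ≤ ∫_{smallField t ∖ A} w_J`;
* `integral_indicator_mul_gaussWeight` / `setIntegral_gaussWeight_le_of_gaussAvg_le` (the hypothesis `gaussAvg β′ H 1_A ≤ p` in integral form);
* arithmetic: `six_card_mul_exp_neg_le_quarter`, `quarter_mass_aux`, `six_card_exp_le_quarter` (the half box keeps `≥ 3/4` of the Gaussian mass when
  `C(1+log H) ≤ βs²`, `288C₃ ≤ C`), `half_sq_third_add_fourth_le_sq`, `event_bracket_le` (`e^{6nε}·K²·e^{nφ} ≤ e^{C·s·H⁵}`),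
  `event_ratio_assembly` (numerator + denominator + Gaussian probability bounds + mass ratio ⇒ `Inum ≤ 2·B·p·Iden`).

Everything proved; no definitions; standard axioms.  HONEST LABEL: inputs of a generic measure-comparison brick for the RECORDED, UNSTAFFED lift L4 of the next
rung U5 (`stub_landauThirdOrder`, LINE-20) reusing STEP 2 of the XL stub S5 of a critic-PASSed DRAFT line; S5, U5, ⟨24004⟩ ⟨24335⟩ ⟨24336⟩ and the seat's
own crux ⟨22884⟩ remain OPEN; no stub is closed by name, no crux, rung or summit is proved; **the Yang–Mills mass gap is NOT proved by this file.**
-/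

set_option autoImplicit false

open MeasureTheory Real Finset

namespace Summit.QuantumFields.YangMills.Theorems.AllWindowsColdBoxBoxHighLine

namespace SmallFieldFP

variable {H : ℕ}

/-! ## The numerator: the integral over `smallField s ∩ A` from above -/

/-- **NUMERATOR.**  With the sandwich `|W + Φ − Q| ≤ εQ` (`ε ≤ 1/2`) and the determinant bound `|det F(U_a)| ≤ K·D₀` on `smallField H T`, `s ≤ T`, `β > 0`,
for every measurable event `A`: `∫_{smallField s ∩ A} w ≤ K·D₀·((2π²)⁻¹)^n · ∫_A e^{−β(1−ε)Q}`. -/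
theorem setIntegral_inter_le {β s T ε K D₀ : ℝ} (hβ : 0 < β) (hsT : s ≤ T) (hε : ε ≤ 1 / 2) (hK : 0 ≤ K) (hD₀ : 0 ≤ D₀)
    (hsand : ∀ a : LandauFree H → E3, (∀ e, ‖a e‖ ≤ T) →
      |boxWilson H (edgeChart H a) + landauPhi H (edgeChart H a) - boxQuadForm H a| ≤ ε * boxQuadForm H a)
    (hdet : ∀ a : LandauFree H → E3, a ∈ smallField H T → |(fpOperator H (edgeChart H a)).det| ≤ K * D₀)
    (r : ℝ) {A : Set (LandauFree H → E3)} (hA : MeasurableSet A) :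
    ∫ a in smallField H s ∩ A, fpChartWeight β H r a ≤
      K * D₀ * (1 / (2 * Real.pi ^ 2)) ^ Fintype.card (LandauFree H) *
        ∫ a in A, Real.exp (-(β * (1 - ε) * boxQuadForm H a)) := by
  have hβ' : 0 < β * (1 - ε) := mul_pos hβ (by linarith)
  have hpow : 0 ≤ (1 / (2 * Real.pi ^ 2)) ^ Fintype.card (LandauFree H) := by positivity
  have hM : 0 ≤ K * D₀ * (1 / (2 * Real.pi ^ 2)) ^ Fintype.card (LandauFree H) := mul_nonneg (mul_nonneg hK hD₀) hpow
  have hS : MeasurableSet (smallField H s ∩ A) := (ChartGauss.measurableSet_smallField s).inter hA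
  -- pointwise domination of the indicator
  have hptw : ∀ a : LandauFree H → E3, (smallField H s ∩ A).indicator (fpChartWeight β H r) a ≤
      K * D₀ * (1 / (2 * Real.pi ^ 2)) ^ Fintype.card (LandauFree H) *
        A.indicator (fun a => Real.exp (-(β * (1 - ε) * boxQuadForm H a))) a := by
    intro a
    by_cases ha : a ∈ smallField H s ∩ A
    · rw [Set.indicator_of_mem ha, Set.indicator_of_mem ha.2]
      have hb : a ∈ smallField H T := fun e => (ha.1 e).trans hsT
      calc fpChartWeight β H r a ≤ |(fpOperator H (edgeChart H a)).det| * (1 / (2 * Real.pi ^ 2)) ^ Fintype.card (LandauFree H) *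
            Real.exp (-(β * (1 - ε) * boxQuadForm H a)) := FPChart.fpChartWeight_le_of_sandwich hβ.le hsand r hb
        _ ≤ K * D₀ * (1 / (2 * Real.pi ^ 2)) ^ Fintype.card (LandauFree H) * Real.exp (-(β * (1 - ε) * boxQuadForm H a)) :=
            mul_le_mul_of_nonneg_right (mul_le_mul_of_nonneg_right (hdet a hb) hpow) (Real.exp_pos _).le
    · rw [Set.indicator_of_notMem ha]
      exact mul_nonneg hM (Set.indicator_nonneg (fun _ _ => (Real.exp_pos _).le) _)
  -- integrate
  have hgi := ChartGauss.integrable_exp_neg_mul_boxQuadForm (H := H) hβ'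
  have hupper : Integrable fun a : LandauFree H → E3 => K * D₀ * (1 / (2 * Real.pi ^ 2)) ^ Fintype.card (LandauFree H) *
      A.indicator (fun a => Real.exp (-(β * (1 - ε) * boxQuadForm H a))) a :=
    (hgi.indicator hA).const_mul _
  rw [← integral_indicator hS]
  calc ∫ a, (smallField H s ∩ A).indicator (fpChartWeight β H r) a
      ≤ ∫ a, K * D₀ * (1 / (2 * Real.pi ^ 2)) ^ Fintype.card (LandauFree H) *
          A.indicator (fun a => Real.exp (-(β * (1 - ε) * boxQuadForm H a))) a :=
        integral_mono_of_nonneg (ae_of_all _ fun a => Set.indicator_nonneg (fun _ _ => FPChart.fpChartWeight_nonneg β r _) _)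
          hupper (ae_of_all _ hptw)
    _ = K * D₀ * (1 / (2 * Real.pi ^ 2)) ^ Fintype.card (LandauFree H) *
          ∫ a in A, Real.exp (-(β * (1 - ε) * boxQuadForm H a)) := by
        rw [integral_const_mul, integral_indicator hA]

/-! ## The denominator: the integral over `smallField t ∖ A` from below -/

/-- **DENOMINATOR.**  With the sandwich at level `T`, the two-sided determinant comparison on `smallField H T`, `0 < r`, `0 ≤ t ≤ min(T, r, 1)`, `0 ≤ ε ≤ 1`,
`K > 0`, for every measurable event `A`:
`K⁻¹·D₀·((2π²)⁻¹)^n·e^{−n(t²/3+t⁴)} · (∫_{smallField t} e^{−β(1+ε)Q} − ∫_A e^{−β(1+ε)Q}) ≤ ∫_{smallField t ∖ A} w`. -/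
theorem le_setIntegral_smallField_diff (hH : 1 ≤ H) {β r t T ε K D₀ : ℝ} (hβ : 0 < β) (hr : 0 < r) (ht0 : 0 ≤ t) (htr : t ≤ r) (ht1 : t ≤ 1)
    (htT : t ≤ T) (hε0 : 0 ≤ ε) (hε1 : ε ≤ 1) (hK : 0 < K) (hD₀ : 0 ≤ D₀)
    (hsand : ∀ a : LandauFree H → E3, (∀ e, ‖a e‖ ≤ T) →
      |boxWilson H (edgeChart H a) + landauPhi H (edgeChart H a) - boxQuadForm H a| ≤ ε * boxQuadForm H a)
    (hdet : ∀ a : LandauFree H → E3, a ∈ smallField H T →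
      |(fpOperator H (edgeChart H a)).det| ≤ K * D₀ ∧ D₀ ≤ K * |(fpOperator H (edgeChart H a)).det|)
    {A : Set (LandauFree H → E3)} (hA : MeasurableSet A) :
    K⁻¹ * D₀ * ((1 / (2 * Real.pi ^ 2)) ^ Fintype.card (LandauFree H) * Real.exp (-(Fintype.card (LandauFree H) * (t ^ 2 / 3 + t ^ 4)))) *
        ((∫ a in smallField H t, Real.exp (-(β * (1 + ε) * boxQuadForm H a))) -
          ∫ a in A, Real.exp (-(β * (1 + ε) * boxQuadForm H a))) ≤
      ∫ a in smallField H t \ A, fpChartWeight β H r a := by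
  have hβ' : 0 < β * (1 + ε) := mul_pos hβ (by linarith)
  have hsand_t : ∀ a : LandauFree H → E3, (∀ e, ‖a e‖ ≤ t) →
      |boxWilson H (edgeChart H a) + landauPhi H (edgeChart H a) - boxQuadForm H a| ≤ ε * boxQuadForm H a :=
    fun a ha => hsand a fun e => (ha e).trans htT
  set c : ℝ := K⁻¹ * D₀ * ((1 / (2 * Real.pi ^ 2)) ^ Fintype.card (LandauFree H) *
    Real.exp (-(Fintype.card (LandauFree H) * (t ^ 2 / 3 + t ^ 4)))) with hc
  have hc0 : 0 ≤ c := by rw [hc]; positivity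
  -- pointwise on the box
  have hptw : ∀ a ∈ smallField H t \ A, c * Real.exp (-(β * (1 + ε) * boxQuadForm H a)) ≤ fpChartWeight β H r a := by
    intro a ha
    have haT : a ∈ smallField H T := fun e => (ha.1 e).trans htT
    have hD : K⁻¹ * D₀ ≤ |(fpOperator H (edgeChart H a)).det| := by
      rw [inv_mul_le_iff₀ hK]
      exact (hdet a haT).2
    have h := FPChart.le_fpChartWeight_of_sandwich hβ.le hr.ne' ht0 htr ht1 hsand_t ha.1
    refine le_trans ?_ h
    rw [hc]
    have hh : 0 ≤ (1 / (2 * Real.pi ^ 2)) ^ Fintype.card (LandauFree H) * Real.exp (-(Fintype.card (LandauFree H) * (t ^ 2 / 3 + t ^ 4))) := by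
      positivity
    exact mul_le_mul_of_nonneg_right (mul_le_mul_of_nonneg_right hD hh) (Real.exp_pos _).le
  -- the Gaussian integral over `smallField t ∖ A` is at least `∫_{smallField t} − ∫_A`
  have hgi := ChartGauss.integrable_exp_neg_mul_boxQuadForm (H := H) hβ'
  have hsplit := integral_inter_add_sdiff (μ := volume) (s := smallField H t) hA hgi.integrableOn
  have hinter : ∫ a in smallField H t ∩ A, Real.exp (-(β * (1 + ε) * boxQuadForm H a)) ≤
      ∫ a in A, Real.exp (-(β * (1 + ε) * boxQuadForm H a)) :=
    setIntegral_mono_set hgi.integrableOn (ae_of_all _ fun a => (Real.exp_pos _).le)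
      (ae_of_all _ (Set.inter_subset_right : smallField H t ∩ A ⊆ A))
  have hdiff : (∫ a in smallField H t, Real.exp (-(β * (1 + ε) * boxQuadForm H a))) -
      ∫ a in A, Real.exp (-(β * (1 + ε) * boxQuadForm H a)) ≤
      ∫ a in smallField H t \ A, Real.exp (-(β * (1 + ε) * boxQuadForm H a)) := by
    linarith
  -- integrate over the box
  have hwi : IntegrableOn (fpChartWeight β H r) (smallField H t \ A) :=
    (integrableOn_fpChartWeight_smallField hH hβ.le hε1 hK.le hD₀ hsand (fun a ha => (hdet a ha).1) r ht0 htT).mono_set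
      Set.sdiff_subset
  calc c * ((∫ a in smallField H t, Real.exp (-(β * (1 + ε) * boxQuadForm H a))) -
          ∫ a in A, Real.exp (-(β * (1 + ε) * boxQuadForm H a)))
      ≤ c * ∫ a in smallField H t \ A, Real.exp (-(β * (1 + ε) * boxQuadForm H a)) := mul_le_mul_of_nonneg_left hdiff hc0
    _ = ∫ a in smallField H t \ A, c * Real.exp (-(β * (1 + ε) * boxQuadForm H a)) := (integral_const_mul _ _).symm
    _ ≤ ∫ a in smallField H t \ A, fpChartWeight β H r a :=
        setIntegral_mono_on (hgi.integrableOn.const_mul c) hwi ((ChartGauss.measurableSet_smallField t).diff hA) hptw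

/-! ## The Gaussian hypothesis in integral form -/

/-- `∫ 1_A · e^{−β′Q} = ∫_A e^{−β′Q}`. -/
theorem integral_indicator_mul_gaussWeight (β' : ℝ) {A : Set (LandauFree H → E3)} (hA : MeasurableSet A) :
    ∫ a, A.indicator (fun _ => (1 : ℝ)) a * gaussWeight β' H a = ∫ a in A, gaussWeight β' H a := by
  rw [← integral_indicator hA]
  refine integral_congr_ae (ae_of_all _ fun a => ?_)
  by_cases ha : a ∈ A
  · simp only [Set.indicator_of_mem ha, one_mul]
  · simp only [Set.indicator_of_notMem ha, zero_mul]

/-- A bound `gaussAvg β′ H 1_A ≤ p` on the Gaussian probability of `A` in integral form: `∫_A e^{−β′Q} ≤ p·∫ e^{−β′Q}` (`β′ > 0`). -/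
theorem setIntegral_gaussWeight_le_of_gaussAvg_le {β' p : ℝ} (hβ' : 0 < β') {A : Set (LandauFree H → E3)} (hA : MeasurableSet A)
    (hp : gaussAvg β' H (A.indicator fun _ => (1 : ℝ)) ≤ p) :
    ∫ a in A, Real.exp (-(β' * boxQuadForm H a)) ≤ p * ∫ a, Real.exp (-(β' * boxQuadForm H a)) := by
  have hZ := ChartGauss.integral_exp_neg_mul_boxQuadForm_pos (H := H) hβ'
  have h : (∫ a in A, Real.exp (-(β' * boxQuadForm H a))) / (∫ a, Real.exp (-(β' * boxQuadForm H a))) ≤ p := by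
    have h1 := hp
    unfold gaussAvg at h1
    rw [integral_indicator_mul_gaussWeight β' hA] at h1
    exact h1
  rwa [div_le_iff₀ hZ] at h

/-! ## Elementary bounds for the packaging -/

/-- `5184·H⁴·e^{−24(1 + log H)} ≤ 1/4`-type bound: `6·(216H⁴)·e^{−a(1+log H)} ≤ 1/4` for `a ≥ 24`, `H ≥ 1`. -/
theorem six_card_mul_exp_neg_le_quarter (hH : 1 ≤ H) {a : ℝ} (ha : 24 ≤ a) :
    6 * (216 * (H : ℝ) ^ 4) * Real.exp (-(a * (1 + Real.log H))) ≤ 1 / 4 := by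
  have hH' : (1 : ℝ) ≤ H := by exact_mod_cast hH
  have hlog : 0 ≤ Real.log H := Real.log_nonneg hH'
  have h1 : Real.exp (-(a * (1 + Real.log H))) ≤ Real.exp (-12) * Real.exp (-(12 * (1 + Real.log H))) := by
    rw [← Real.exp_add]
    refine Real.exp_le_exp.2 ?_
    nlinarith [mul_le_mul_of_nonneg_right ha (show (0:ℝ) ≤ 1 + Real.log H by linarith)]
  have h2 := card_mul_exp_neg_le_one hH (le_refl (12 : ℝ))
  have h3 : Real.exp (-12) ≤ 1 / 8 := by
    rw [Real.exp_neg, inv_le_comm₀ (Real.exp_pos _) (by norm_num)]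
    have : (1 / 8 : ℝ)⁻¹ = 8 := by norm_num
    rw [this]
    linarith [Real.add_one_le_exp (12 : ℝ)]
  have h4 : 2592 * (H : ℝ) ^ 4 * Real.exp (-(12 * (1 + Real.log H))) ≤ 1 := h2
  have h5 : 0 ≤ 2592 * (H : ℝ) ^ 4 * Real.exp (-(12 * (1 + Real.log H))) := by positivity
  calc 6 * (216 * (H : ℝ) ^ 4) * Real.exp (-(a * (1 + Real.log H)))
      ≤ 6 * (216 * (H : ℝ) ^ 4) * (Real.exp (-12) * Real.exp (-(12 * (1 + Real.log H)))) :=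
        mul_le_mul_of_nonneg_left h1 (by positivity)
    _ = Real.exp (-12) * (2592 * (H : ℝ) ^ 4 * Real.exp (-(12 * (1 + Real.log H)))) / 2 := by ring
    _ ≤ 1 / 8 * 1 / 2 := by
        have h6 : Real.exp (-12) * (2592 * (H : ℝ) ^ 4 * Real.exp (-(12 * (1 + Real.log H)))) ≤ 1 / 8 * 1 :=
          mul_le_mul h3 h4 h5 (by norm_num)
        linarith
    _ ≤ 1 / 4 := by norm_num

/-- Arithmetic for the denominator: `C(1+log H) ≤ βs²` with `288C₃ ≤ C` gives `24(1+log H)·(3C₃) ≤ β(1+ε)(s/2)²`. -/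
theorem quarter_mass_aux {β ε s C C₃ L : ℝ} (hβ : 0 ≤ β) (hε0 : 0 ≤ ε) (hC : 288 * C₃ ≤ C) (hL : 0 ≤ L)
    (hCβ : C * L ≤ β * s ^ 2) : 24 * L * (3 * C₃) ≤ β * (1 + ε) * (s / 2) ^ 2 := by
  have h1 : 288 * C₃ * L ≤ C * L := mul_le_mul_of_nonneg_right hC hL
  have h2 : 0 ≤ β * ε * s ^ 2 := mul_nonneg (mul_nonneg hβ hε0) (sq_nonneg s)
  nlinarith

/-- `(s/2)²/3 + (s/2)⁴ ≤ s²` for `0 ≤ s ≤ 1`. -/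
theorem half_sq_third_add_fourth_le_sq {s : ℝ} (hs0 : 0 ≤ s) (hs1 : s ≤ 1) : (s / 2) ^ 2 / 3 + (s / 2) ^ 4 ≤ s ^ 2 := by
  have h4 : (s / 2) ^ 4 ≤ (s / 2) ^ 2 := by
    have : (s / 2) ^ 4 = (s / 2) ^ 2 * (s / 2) ^ 2 := by ring
    rw [this]; exact mul_le_of_le_one_left (sq_nonneg _) (by nlinarith)
  nlinarith [sq_nonneg s]

/-- The denominator keeps three quarters of the Gaussian mass: `6n·e^{−β(1+ε)(s/2)²/(3C₃)} ≤ 1/4` when `C(1+log H) ≤ βs²`, `288C₃ ≤ C`. -/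
theorem six_card_exp_le_quarter (hH : 1 ≤ H) {β ε s C C₃ : ℝ} (hβ : 0 ≤ β) (hε0 : 0 ≤ ε) (hC₃ : 0 < C₃) (hC : 288 * C₃ ≤ C)
    (hlog : 0 ≤ Real.log H) (hCβ : C * (1 + Real.log H) ≤ β * s ^ 2) :
    6 * (Fintype.card (LandauFree H) : ℝ) * Real.exp (-(β * (1 + ε) * (s / 2) ^ 2 / (3 * C₃))) ≤ 1 / 4 := by
  have hE : Real.exp (-(β * (1 + ε) * (s / 2) ^ 2 / (3 * C₃))) ≤ Real.exp (-(24 * (1 + Real.log H))) := by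
    refine Real.exp_le_exp.2 (neg_le_neg ?_)
    rw [le_div_iff₀ (by positivity)]
    exact quarter_mass_aux hβ hε0 hC (by linarith) hCβ
  have hn := card_landauFree_le hH
  calc 6 * (Fintype.card (LandauFree H) : ℝ) * Real.exp (-(β * (1 + ε) * (s / 2) ^ 2 / (3 * C₃)))
      ≤ 6 * (216 * (H : ℝ) ^ 4) * Real.exp (-(24 * (1 + Real.log H))) :=
        mul_le_mul (mul_le_mul_of_nonneg_left hn (by norm_num)) hE (Real.exp_pos _).le (by positivity)
    _ ≤ 1 / 4 := six_card_mul_exp_neg_le_quarter hH le_rfl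

/-- **The bracket**: `e^{6nε}·K²·e^{nφ} ≤ e^{C·s·H⁵}` with `ε = C₆⁺sH`, `K = e^{C₇⁺sH⁵}`, `φ = (s/2)²/3 + (s/2)⁴ ≤ s²`, `n ≤ 216H⁴`, `s ≤ 1`,
`C = 2C₇⁺ + 216 + 1296C₆⁺ + 288C₃`. -/
theorem event_bracket_le (hH : 1 ≤ H) {n s C₆p C₇p C₃ : ℝ} (hn : n ≤ 216 * (H : ℝ) ^ 4) (hs0 : 0 ≤ s) (hs1 : s ≤ 1)
    (hC₆p : 0 ≤ C₆p) (hC₃ : 0 ≤ C₃) :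
    Real.exp (6 * n * (C₆p * s * H)) * Real.exp (C₇p * s * (H : ℝ) ^ 5) ^ 2 * Real.exp (n * ((s / 2) ^ 2 / 3 + (s / 2) ^ 4)) ≤
      Real.exp ((2 * C₇p + 216 + 1296 * C₆p + 288 * C₃) * s * (H : ℝ) ^ 5) := by
  have hH' : (1 : ℝ) ≤ H := by exact_mod_cast hH
  have hφ := half_sq_third_add_fourth_le_sq hs0 hs1
  have hsH5 : 0 ≤ s * (H : ℝ) ^ 5 := by positivity
  have hs2 : s ^ 2 ≤ s * H := by rw [sq]; exact mul_le_mul_of_nonneg_left (hs1.trans hH') hs0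
  rw [← Real.exp_nat_mul, ← Real.exp_add, ← Real.exp_add]
  refine Real.exp_le_exp.2 ?_
  have e1 : 6 * n * (C₆p * s * H) ≤ 1296 * C₆p * (s * (H : ℝ) ^ 5) := by
    calc 6 * n * (C₆p * s * H) ≤ 6 * (216 * (H : ℝ) ^ 4) * (C₆p * s * H) :=
          mul_le_mul_of_nonneg_right (by linarith) (by positivity)
      _ = 1296 * C₆p * (s * (H : ℝ) ^ 5) := by ring
  have e3 : n * ((s / 2) ^ 2 / 3 + (s / 2) ^ 4) ≤ 216 * (s * (H : ℝ) ^ 5) := by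
    calc n * ((s / 2) ^ 2 / 3 + (s / 2) ^ 4) ≤ 216 * (H : ℝ) ^ 4 * s ^ 2 := mul_le_mul hn hφ (by positivity) (by positivity)
      _ ≤ 216 * (H : ℝ) ^ 4 * (s * H) := mul_le_mul_of_nonneg_left hs2 (by positivity)
      _ = 216 * (s * (H : ℝ) ^ 5) := by ring
  have e4 : 0 ≤ 288 * C₃ * (s * (H : ℝ) ^ 5) := by positivity
  push_cast
  nlinarith [e1, e3, e4, hsH5]

/-- **The ratio assembly** (pure arithmetic on opaque reals): numerator bound `hU`, denominator bound `hL`, the Gaussian probability bounds `hAm`/`hAp`,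
the mass ratio `hZ`, the box mass `hbox` with `q ≤ 1/4`, `p ≤ 1/4`, and the bracket `hbr` give `Inum ≤ 2·B·p·Iden`. -/
theorem event_ratio_assembly {Inum Iden K D₀ P g Zp Zm Ap Am ρN p B q Ibox : ℝ}
    (hK : 0 < K) (hD₀ : 0 ≤ D₀) (hP : 0 < P) (hZp : 0 < Zp) (hρN : 0 < ρN)
    (hU : Inum ≤ K * D₀ * P * Am)
    (hL : K⁻¹ * D₀ * (P * Real.exp (-g)) * (Ibox - Ap) ≤ Iden)
    (hAm : Am ≤ p * Zm) (hAm0 : 0 ≤ Am) (hAp : Ap ≤ p * Zp) (hZ : Zm = ρN * Zp)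
    (hbox : (1 - q) * Zp ≤ Ibox) (hq : q ≤ 1 / 4) (hp4 : p ≤ 1 / 4)
    (hbr : ρN * K ^ 2 * Real.exp g ≤ B) :
    Inum ≤ 2 * B * p * Iden := by
  set G : ℝ := Real.exp g with hGdef
  have hG : 0 < G := Real.exp_pos _
  have hGinv : Real.exp (-g) = G⁻¹ := by rw [Real.exp_neg]
  rw [hGinv] at hL
  -- `0 ≤ p`
  have hp0 : 0 ≤ p := by
    by_contra hneg
    push Not at hneg
    have h1 : p * (ρN * Zp) < 0 := mul_neg_of_neg_of_pos hneg (mul_pos hρN hZp)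
    have h2 : 0 ≤ p * (ρN * Zp) := by rw [← hZ]; exact hAm0.trans hAm
    linarith only [h1, h2]
  -- the denominator
  have hmass : 1 / 2 * Zp ≤ Ibox - Ap := by
    have h1 : Ap ≤ 1 / 4 * Zp := hAp.trans (mul_le_mul_of_nonneg_right hp4 hZp.le)
    have h2 : 0 ≤ (1 / 4 - q) * Zp := mul_nonneg (by linarith only [hq]) hZp.le
    nlinarith only [h1, h2, hbox]
  have hc : 0 ≤ K⁻¹ * D₀ * (P * G⁻¹) := mul_nonneg (mul_nonneg (inv_nonneg.mpr hK.le) hD₀) (mul_nonneg hP.le (inv_nonneg.mpr hG.le))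
  have hB : K⁻¹ * D₀ * (P * G⁻¹) * (1 / 2 * Zp) ≤ Iden := (mul_le_mul_of_nonneg_left hmass hc).trans hL
  -- the numerator
  have hA : Inum ≤ (2 * (ρN * K ^ 2 * G)) * p * (K⁻¹ * D₀ * (P * G⁻¹) * (1 / 2 * Zp)) := by
    refine hU.trans ?_
    have hstep : K * D₀ * P * Am ≤ K * D₀ * P * (p * (ρN * Zp)) := by
      rw [← hZ]; exact mul_le_mul_of_nonneg_left hAm (mul_nonneg (mul_nonneg hK.le hD₀) hP.le)
    refine hstep.trans (le_of_eq ?_)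
    field_simp
  -- assemble
  have hB0 : ρN * K ^ 2 * G ≤ B := hbr
  have h2 : 0 ≤ 2 * B * p := mul_nonneg (mul_nonneg (by norm_num) ((by positivity : (0:ℝ) ≤ ρN * K ^ 2 * G).trans hB0)) hp0
  calc Inum ≤ (2 * (ρN * K ^ 2 * G)) * p * (K⁻¹ * D₀ * (P * G⁻¹) * (1 / 2 * Zp)) := hA
    _ ≤ (2 * B) * p * (K⁻¹ * D₀ * (P * G⁻¹) * (1 / 2 * Zp)) :=
        mul_le_mul_of_nonneg_right (mul_le_mul_of_nonneg_right (by linarith only [hB0]) hp0)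
          (mul_nonneg hc (mul_nonneg (by norm_num) hZp.le))
    _ ≤ (2 * B) * p * Iden := mul_le_mul_of_nonneg_left hB h2
    _ = 2 * B * p * Iden := by ring

end SmallFieldFP

end Summit.QuantumFields.YangMills.Theorems.AllWindowsColdBoxBoxHighLine
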